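import Summits.CriticalPhenomena.PercolationContinuityZ3.Theorems.PercNearOneGluingNoHeavyLowerTailSahiLatinBridge
import Summits.CriticalPhenomena.PercolationContinuityZ3.Theorems.PercNearOneGluingNoHeavyLowerTailSahiThreeChainsBridgeKernel

/-!
# `NoHeavyLowerTail` (crux stmt-CriticalPhenomena-4575), Sahi programme (prim-master-conj gen 42): FBP(3,3) in the all-`d` framework —
# `LatinPos (Fin 3)` from the kernel-checked three-chains certificate of gen 40

Support file (`--supports stmt-CriticalPhenomena-4575`).  The general-`d` Latin kernel `SahiLatin.kappa` on `[3]^ι = ι → Fin 3`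
(`…SahiLatinKernel`) specialises at `ι = Fin 3` to gen 40's `SahiThreeChains.latinSum` on `Fin 3 × Fin 3 × Fin 3` (transfer along
`f ↦ (f 0, f 1, f 2)`, `latinSum_mapQ`), whose nonnegativity on up-set triples is the tree theorem `SahiThreeChains.latinSum_nonneg`
(exhaustive in-kernel check of `[3]³`, blocks `…SahiThreeChainsCheckA–D`).  Hence:
* `latinPos_fin_three : LatinPos (Fin 3)` — FBP(3,3) in the all-`d` vocabulary (the input `κ₃ ≥ 0` ON THE LINK needed by the order-4
  ladder in dimension 3, memo `…-g41-DESCENT.md` §10), and `terminalPos_fin_three`;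
* `sahiPositive_three_pi_fin_three` — Sahi's `E₃ ≥ 0` on `Π_{i : Fin 3} α_i` for every three finite linear orders and every product
  probability weight, now as an instance of the all-`d` bridge `SahiLatin.sahiPositive_three_prodW'` (gen 40 proved the same on the
  explicit triple product `Fin m₁ × Fin m₂ × Fin m₃`).
COMPUTATIONAL through the imported blocks.  Everything here is proved; axioms standard (+ `Lean.ofReduceBool` via the imported
`native_decide` certificate, as for gen 40's theorem).
-/

namespace Summit.CriticalPhenomena.PercolationContinuityZ3.Theorems.SahiLatin

open Finset Literature.Combinatorics.Sahi2008

/-! ## The transfer `[3]^{Fin 3} ≃o Fin 3 × Fin 3 × Fin 3` -/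

/-- `f ↦ (f 0, f 1, f 2)`. [this work] -/
def e3 (f : Pt (Fin 3)) : SahiThreeChains.Q := (f 0, f 1, f 2)

/-- `(i, j, k) ↦ ![i, j, k]`. [this work] -/
def e3inv (q : SahiThreeChains.Q) : Pt (Fin 3) := ![q.1, q.2.1, q.2.2]

/-- `e3inv ∘ e3 = id`. [this work] -/
@[simp] theorem e3inv_e3 (f : Pt (Fin 3)) : e3inv (e3 f) = f := by
  funext i; fin_cases i <;> rfl

/-- `e3 ∘ e3inv = id`. [this work] -/
@[simp] theorem e3_e3inv (q : SahiThreeChains.Q) : e3 (e3inv q) = q := rfl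

/-- `e3` is injective. [this work] -/
theorem e3_injective : Function.Injective e3 := fun f g h => by rw [← e3inv_e3 f, h, e3inv_e3]

/-- `e3` is an order embedding. [this work] -/
theorem e3_le_iff {f g : Pt (Fin 3)} : e3 f ≤ e3 g ↔ f ≤ g := by
  constructor
  · rintro ⟨h0, h1, h2⟩ i
    fin_cases i
    · exact h0
    · exact h1
    · exact h2
  · intro h; exact ⟨h 0, h 1, h 2⟩

/-- Transport of a finset of `[3]^{Fin 3}` to the triple product. [this work] -/
def mapQ (a : Finset (Pt (Fin 3))) : Finset SahiThreeChains.Q := a.map ⟨e3, e3_injective⟩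

/-- Membership in the transported set. [this work] -/
theorem mem_mapQ {a : Finset (Pt (Fin 3))} {q : SahiThreeChains.Q} : q ∈ mapQ a ↔ e3inv q ∈ a := by
  rw [mapQ, mem_map]
  constructor
  · rintro ⟨f, hf, rfl⟩
    simpa using hf
  · intro h
    exact ⟨e3inv q, h, e3_e3inv q⟩

/-- Membership of an image point. [this work] -/
theorem e3_mem_mapQ {a : Finset (Pt (Fin 3))} {f : Pt (Fin 3)} : e3 f ∈ mapQ a ↔ f ∈ a := by
  rw [mem_mapQ, e3inv_e3]

/-- The transport of an up-set is an up-set. [this work] -/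
theorem isUpperSet_mapQ {a : Finset (Pt (Fin 3))} (ha : IsUpperSet (a : Set (Pt (Fin 3)))) :
    IsUpperSet ((mapQ a : Finset SahiThreeChains.Q) : Set SahiThreeChains.Q) := by
  intro q q' hqq' hq
  rw [Finset.mem_coe, mem_mapQ] at hq ⊢
  refine ha ?_ hq
  rw [← e3_le_iff, e3_e3inv, e3_e3inv]; exact hqq'

/-- The index sets of Latin triples correspond: `ρ ↦ (ρ 0, ρ 1, ρ 2)`. [this work] -/
def E3 : LPerm (Fin 3) ≃ SahiThreeChains.Perm3 where
  toFun ρ := (ρ 0, ρ 1, ρ 2)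
  invFun π := ![π.1, π.2.1, π.2.2]
  left_inv ρ := by funext i; fin_cases i <;> rfl
  right_inv π := rfl

/-- Latin triples correspond: `dtrip (E3 ρ) j = e3 (ρ·j)`. [this work] -/
theorem dtrip_E3 (ρ : LPerm (Fin 3)) (j : Fin 3) : SahiThreeChains.dtrip (E3 ρ) j = e3 (lpt ρ j) := rfl

/-- Indicators correspond. [this work] -/
theorem chi_mapQ_e3 (a : Finset (Pt (Fin 3))) (f : Pt (Fin 3)) : SahiThreeChains.chi (mapQ a) (e3 f) = ((ind a f : ℤ) : ℝ) := by
  rw [SahiThreeChains.chi, ind]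
  by_cases h : f ∈ a
  · simp [e3_mem_mapQ, h]
  · simp [e3_mem_mapQ, h]

/-- **The Latin kernel at `ι = Fin 3` is gen 40's `latinSum` of the transported triple.** [this work] -/
theorem latinSum_mapQ (a b c : Finset (Pt (Fin 3))) :
    SahiThreeChains.latinSum (mapQ a) (mapQ b) (mapQ c) = ((kappa a b c : ℤ) : ℝ) := by
  rw [SahiThreeChains.latinSum, kappa, Int.cast_sum, ← Equiv.sum_comp E3]
  refine sum_congr rfl fun ρ _ => ?_
  simp only [SahiThreeChains.Gfun, dtrip_E3, chi_mapQ_e3, G]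
  push_cast
  ring

/-- **FBP(3,3)** in the all-`d` framework: the Latin kernel is nonnegative on every up-set triple of `[3]^{Fin 3}`
(from the kernel-checked certificate `SahiThreeChains.latinSum_nonneg`). [this work] -/
theorem latinPos_fin_three : LatinPos (Fin 3) := by
  intro a b c hup
  obtain ⟨ha, hb, hc⟩ := hup
  have h := SahiThreeChains.latinSum_nonneg (isUpperSet_mapQ ha) (isUpperSet_mapQ hb) (isUpperSet_mapQ hc)
  rw [latinSum_mapQ] at h
  exact_mod_cast h

/-- Terminal positivity of `[3]³` (a fortiori). [this work] -/
theorem terminalPos_fin_three : TerminalPos (Fin 3) := latinPos_iff_terminalPos.1 latinPos_fin_three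

/-- **Sahi's `E₃ ≥ 0` on every product of THREE finite linear orders `Π_{i : Fin 3} α_i`, every product probability weight** —
gen 40's three-chains theorem as an instance of the all-`d` bridge. [this work] -/
theorem sahiPositive_three_pi_fin_three {α : Fin 3 → Type*} [∀ i, Fintype (α i)] [∀ i, LinearOrder (α i)]
    (w : ∀ i, α i → ℝ) (hw : ∀ i x, 0 ≤ w i x) (hw1 : ∀ i, ∑ x, w i x = 1) :
    SahiPositive (fun p : (∀ i, α i) => ∏ i, w i (p i)) 3 :=
  sahiPositive_three_prodW' latinPos_fin_three w hw hw1

end Summit.CriticalPhenomena.PercolationContinuityZ3.Theorems.SahiLatin
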